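import Summits.BirchSwinnertonDyer.BirchSwinnertonDyer.Theorems.ErratumRoadFiveShimuraKolyvaginOrderBoundInertShiftCebotarev
import Literature.NumberTheory.EllipticCurves.CasselsTateSelmerKolyvaginValue
import HarnessLib

/-!
# Transport of the swap supply's `κ̄` statements ALONG THE CHANGE OF LEVEL `ι_* : H¹(K, E[d]) → H¹(K, E[n])`:
# local vanishing at a place whose decomposition group fixes `E[n]` (Prop. 4.4's non-vanishing form), and the
# `τ`-sign — so that `h44c` and the sign half of `hκSel` for the level-`p` avatars `κ̄_n` (`…KolyJLevelOneAvatar`) READ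
# as the corresponding statements about `c_{M+1}(n)`, i.e. in the walk's currency
# (cell `bsd-stepL`, seat `bsd-stepL-corner-p1` g8; `--supports stmt-BirchSwinnertonDyer-19947`)

WHAT. `exists_levelOne_avatar` gives `κ̄_n ∈ H¹(K, E[p])` with `ι_* κ̄_n = c_{M+1}(n)`. The swap supply
(`Koly.exists_deep_of_swapFamilies'`) asks about `κ̄`: (a) `h44c`: `loc_λ κ̄_{nℓ} = 0 ↔ loc_λ κ̄_n = 0` at a Kolyvagin prime
`ℓ ∤ n` of index `≥ M + 1`; (b) the sign `τ κ̄_n = ε_n κ̄_n`; (c) Selmer membership. Here: (a) is the SAME statement for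
`c_{M+1}` once `Γ_{K_λ}` fixes `E[p^{M+1}]` (`localization_eq_zero_iff_torsionH1OfDvd`, from shim-p1's
`mem_torsionLocalKer_iff_torsionH1OfDvd_mem` and the tree's `mem_torsionLocalKer_iff_res_eq_zero`) —
`localization_eq_zero_iff_transport`; (b) follows from the sign of `c_{M+1}(n)` and the injectivity of `ι_*`
(`conjAct_eq_smul_of_torsionH1OfDvd`, from `conjAct_torsionH1OfDvd`). (c) at the Kummer places is `torsionH1ToH1_torsionH1OfDvd`
(tree); at the transverse places it is a compatibility of the supplier's structures `𝒯_1`, `𝒯_{M+1}` — not touched here.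
HONEST FRAMING: three small theorems, no definition ∕ fact ∕ sorry; nothing about any curve; no stub closes; T7.
References: [McCallumLMS1991] §3 (3), §4 Prop. 4.4, Lemma 4.6; [GrossLMS1991] Prop. 5.4, Prop. 9.6.
-/

set_option autoImplicit false
set_option linter.dupNamespace false

noncomputable section

open scoped Classical NumberField

namespace Summit.BirchSwinnertonDyer.BirchSwinnertonDyer.Theorems

open WeierstrassCurve NumberField IsDedekindDomain Field
  Literature.NumberTheory.EllipticCurves Literature.NumberTheory.GaloisRepresentations

universe u

variable {K : Type u} [Field K] [NumberField K] (W : WeierstrassCurve ℚ) [W.IsElliptic]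

/-- **Local vanishing is invariant under the change of level** at a place `v` whose absolute Galois group fixes
`E[n]` (`d ∣ n`): `loc_v x = 0 ↔ loc_v (ι_* x) = 0` for `x ∈ H¹(K, E[d])` — McCallum §3 (3) ∕ Gross Prop. 9.6 («`E(K_λ)_{p^M} = E_{p^M}`» at a Kolyvagin prime of index `≥` the exponent of `n`). [cite: McCallumLMS1991, §3 (3), §4 Lemma 4.6]
[cite: GrossLMS1991, Prop. 9.6] -/
theorem localization_eq_zero_iff_torsionH1OfDvd {d n : ℕ} (hdn : d ∣ n) (hd : d ≠ 0) (hn : n ≠ 0)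
    (v : HeightOneSpectrum (𝓞 K))
    (htriv : ∀ (g : absoluteGaloisGroup (v.adicCompletion K)) (Q : geomTorsion (W.baseChange K) ((n : ℕ) : ℤ)),
      resGal (K := K) (v.adicCompletion K) g • Q = Q)
    (x : galH1Torsion (W.baseChange K) ((d : ℕ) : ℤ)) :
    galoisCohomology.localization ((W.baseChange K).torsionGaloisModule ((d : ℕ) : ℤ)) (Sum.inr v) 1 x = 0 ↔
      galoisCohomology.localization ((W.baseChange K).torsionGaloisModule ((n : ℕ) : ℤ)) (Sum.inr v) 1
        (torsionH1OfDvd (W.baseChange K) (Int.natCast_dvd_natCast.mpr hdn) x) = 0 := by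
  haveI : CharZero (v.adicCompletion K) :=
    charZero_of_injective_algebraMap (algebraMap K (v.adicCompletion K)).injective
  haveI : (W.baseChange K).IsElliptic := inferInstanceAs (W.map (algebraMap ℚ K)).IsElliptic
  have h1 := mem_torsionLocalKer_iff_res_eq_zero (W.baseChange K) (v.adicCompletion K) hd x
  have h2 := mem_torsionLocalKer_iff_res_eq_zero (W.baseChange K) (v.adicCompletion K) hn
    (torsionH1OfDvd (W.baseChange K) (Int.natCast_dvd_natCast.mpr hdn) x)
  have h3 := mem_torsionLocalKer_iff_torsionH1OfDvd_mem (W.baseChange K) (v.adicCompletion K) hdn hd hn htriv x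
  exact (h1.symm.trans h3).trans h2

/-- **Prop. 4.4 in non-vanishing form TRANSPORTS along `ι_*`**: if `loc_v (ι_* x) = 0 ↔ loc_v (ι_* y) = 0` (the level-`n`
statement, e.g. for `c_{M+1}(nℓ)` and `c_{M+1}(n)` at `λ`), then `loc_v x = 0 ↔ loc_v y = 0` (the level-`d` statement for
the avatars). [cite: McCallumLMS1991, §4 Prop. 4.4, Lemma 4.6] -/
theorem localization_eq_zero_iff_transport {d n : ℕ} (hdn : d ∣ n) (hd : d ≠ 0) (hn : n ≠ 0)
    (v : HeightOneSpectrum (𝓞 K))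
    (htriv : ∀ (g : absoluteGaloisGroup (v.adicCompletion K)) (Q : geomTorsion (W.baseChange K) ((n : ℕ) : ℤ)),
      resGal (K := K) (v.adicCompletion K) g • Q = Q)
    (x y : galH1Torsion (W.baseChange K) ((d : ℕ) : ℤ))
    (h : galoisCohomology.localization ((W.baseChange K).torsionGaloisModule ((n : ℕ) : ℤ)) (Sum.inr v) 1
          (torsionH1OfDvd (W.baseChange K) (Int.natCast_dvd_natCast.mpr hdn) x) = 0 ↔
        galoisCohomology.localization ((W.baseChange K).torsionGaloisModule ((n : ℕ) : ℤ)) (Sum.inr v) 1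
          (torsionH1OfDvd (W.baseChange K) (Int.natCast_dvd_natCast.mpr hdn) y) = 0) :
    galoisCohomology.localization ((W.baseChange K).torsionGaloisModule ((d : ℕ) : ℤ)) (Sum.inr v) 1 x = 0 ↔
      galoisCohomology.localization ((W.baseChange K).torsionGaloisModule ((d : ℕ) : ℤ)) (Sum.inr v) 1 y = 0 := by
  rw [localization_eq_zero_iff_torsionH1OfDvd W hdn hd hn v htriv x,
    localization_eq_zero_iff_torsionH1OfDvd W hdn hd hn v htriv y]
  exact h

omit [W.IsElliptic] in
/-- **The `τ`-sign TRANSPORTS along an injective `ι_*`**: if `τ (ι_* x) = e • ι_* x` then `τ x = e • x`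
(`conjAct_torsionH1OfDvd`: `ι_*` is `Aut(K/ℚ)`-equivariant). With `E(K)[p] = 0` the change of level
`H¹(K, E[p^M]) → H¹(K, E[p^{M+k}])` is injective (`torsionH1OfDvd_pow_injective_of_torsionBy_eq_bot`).
[cite: GrossLMS1991, Prop. 5.4] [cite: McCallumLMS1991, §4 Lemma 4.6] -/
theorem conjAct_eq_smul_of_torsionH1OfDvd (c : K ≃ₐ[ℚ] K) {d n : ℤ} (hdn : d ∣ n)
    (hinj : Function.Injective (torsionH1OfDvd (W.baseChange K) hdn)) (e : ℤ)
    (x : galH1Torsion (W.baseChange K) d)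
    (h : conjAct W c n (torsionH1OfDvd (W.baseChange K) hdn x) = e • torsionH1OfDvd (W.baseChange K) hdn x) :
    conjAct W c d x = e • x := by
  apply hinj
  rw [← conjAct_torsionH1OfDvd W c hdn x, h, map_zsmul]


/-! ### §4 The Kummer places: Selmer local kernels are cartesian under the change of level -/

section Kummer

variable {F : Type u} [Field F] (X : WeierstrassCurve F) (E : Type u) [Field E] [Algebra F E]

/-- **The local Kummer kernel is CARTESIAN under `ι_*`**: for `d ∣ n`, a `F`-field `E` and `x ∈ H¹(F, E[d])`,
`x ∈ ker(H¹(F, E[d]) → H¹(E, E(F̄_E))) ↔ ι_* x ∈ ker(H¹(F, E[n]) → H¹(E, E(F̄_E)))` — the two maps to `H¹(E, E)` form a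
commuting triangle with `ι_*` (functoriality of `H¹` in compatible pairs, `resH1Hom_comp`). So the Selmer condition at a
Kummer place of the level-`p` avatar `κ̄_n` is that of `c_{M+1}(n)` (the part (c) of the module docstring, Kummer places).
[cite: McCallumLMS1991, §4 Lemma 4.3, Lemma 4.6] [cite: SilvermanAEC2009, X.§4 (Remark 4.1.1)] -/
theorem mem_selmerLocalKer_iff_torsionH1OfDvd_mem {d n : ℤ} (h : d ∣ n) (x : galH1Torsion X d) :
    x ∈ selmerLocalKer X E d ↔ torsionH1OfDvd X h x ∈ selmerLocalKer X E n := by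
  have hcomp : (resH1Hom (resGal (K := F) E) ((pointsMap X E).comp (geomTorsion X n).subtype)
        (fun σ P ↦ by
          simp only [AddMonoidHom.coe_comp, AddSubgroup.coe_subtype, Function.comp_apply,
            Literature.NumberTheory.EllipticCurves.AddSubgroup.torsionBy.coe_smul]
          exact pointsMap_smul X E σ P)).comp (torsionH1OfDvd X h) =
      resH1Hom (resGal (K := F) E) ((pointsMap X E).comp (geomTorsion X d).subtype)
        (fun σ P ↦ by
          simp only [AddMonoidHom.coe_comp, AddSubgroup.coe_subtype, Function.comp_apply,
            Literature.NumberTheory.EllipticCurves.AddSubgroup.torsionBy.coe_smul]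
          exact pointsMap_smul X E σ P) := by
    rw [torsionH1OfDvd, resH1Hom_comp]
    exact resH1Hom_congr rfl (AddMonoidHom.ext fun _ ↦ rfl) _ _
  rw [selmerLocalKer, selmerLocalKer, resKer_eq_ker, resKer_eq_ker, AddMonoidHom.mem_ker, AddMonoidHom.mem_ker,
    ← AddMonoidHom.comp_apply, hcomp]

end Kummer

end Summit.BirchSwinnertonDyer.BirchSwinnertonDyer.Theorems

end
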